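import Summits.NavierStokesRegularity.NavierStokesRegularity.Theorems.SoloRefuteZeroual2026

/-! # REF-2 charitable column for C157 `Zeroual2026` — CHARITY-E (energy ball) for Thm 4.1

The companion record (Zenodo 19514768) re-defines the constant of Thm 4.1 as an infimum over an energy
ball `‖u‖²_{L²} ≤ M`. The quotient `‖Au‖²_{L²}/‖u‖²_{L² log L}` is amplitude-INVARIANT (`|au|/‖au‖_{L²} =
|u|/‖u‖_{L²}` inside the log), so the kit's spread-out witness `U_{1,b}` rescaled to amplitude `a` sits in
every ball and keeps its quotient `→ 0`: the energy-ball charity fails for every constants package `K` and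
every ball `M > 0`. Imports ONLY the landed kit of record (p-id per the filer) + its skeleton.
WHAT THIS IS NOT: not a claim about NS regularity or blow-up; not a claim about any author beyond the typed locator. -/

set_option linter.dupNamespace false

open MeasureTheory Literature.Claims.NS.Zeroual2026
open Summit.NavierStokesRegularity.NavierStokesRegularity.Theorems.Zeroual2026
open Summit.NavierStokesRegularity.NavierStokesRegularity.Theorems.Magsanop2026

namespace Summit.NavierStokesRegularity.NavierStokesRegularity.Theorems.Zeroual2026Retype

/-- CHARITY-E: Thm 4.1 (4.1) restricted to the energy ball `‖u‖²_{L²} ≤ M` (the companion's `C*_L(E₀)`). -/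
def Step1_Thm41_ball (K : Constants) (M : ℝ) : Prop :=
  (∀ u : E3 → E3, InDA u → l2Sq u ≤ M → K.Cstar * olSq u ≤ stokesSq u) ∧ 0 < K.Cstar

/-- The witness family is amplitude-linear: `fam a b = a • fam 1 b`. [folklore] -/
theorem fam_eq_smul (a b : ℝ) : fam a b = fun x => a • fam 1 b x := by
  funext x
  simp [fam, scaleField]

/-- `‖fam a b‖_{L²} = |a| ‖fam 1 b‖_{L²}`. [folklore] -/
theorem l2_fam (a : ℝ) {b : ℝ} (hb : 0 < b) : l2 (fam a b) = |a| * l2 (fam 1 b) := by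
  unfold l2
  rw [l2Sq_fam a hb, l2Sq_fam 1 hb, one_pow, one_mul, mul_assoc, Real.sqrt_mul (sq_nonneg a),
    Real.sqrt_sq_eq_abs]

/-- amplitude scaling of the Orlicz functional along the family. -/
theorem olSq_fam (a : ℝ) {b : ℝ} (hb : 0 < b) (ha : a ≠ 0) : olSq (fam a b) = a ^ 2 * olSq (fam 1 b) := by
  unfold olSq
  rw [l2_fam a hb]
  have ha' : 0 < |a| := abs_pos.2 ha
  have h : (fun x => ‖fam a b x‖ ^ 2 * Real.log (Real.exp 1 + ‖fam a b x‖ / (|a| * l2 (fam 1 b)))) =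
      fun x => a ^ 2 * (‖fam 1 b x‖ ^ 2 * Real.log (Real.exp 1 + ‖fam 1 b x‖ / l2 (fam 1 b))) := by
    funext x
    have hx : ‖fam a b x‖ = |a| * ‖fam 1 b x‖ := by
      rw [fam_eq_smul a b]; simp [norm_smul]
    rw [hx, mul_pow, sq_abs, mul_div_mul_left _ _ ha'.ne']
    ring
  rw [h, integral_const_mul]

/-- **CHARITY-E fails**: Thm 4.1 restricted to any energy ball `‖u‖²_{L²} ≤ M`, `M > 0`, is false for
every constants package `K` — the log quotient is amplitude-invariant, so the spread-out witness
rescaled into the ball keeps its quotient `→ 0`. [cite: Zeroual2026, Thm 4.1 (4.1) p.7 l.10–42] -/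
theorem not_Step1_Thm41_ball (K : Constants) {M : ℝ} (hM : 0 < M) : ¬ Step1_Thm41_ball K M := by
  rintro ⟨hle, hpos⟩
  obtain ⟨b, hb0, -, hlt⟩ := exists_violator hpos one_ne_zero
  -- amplitude `a` small enough for the ball
  set S : ℝ := l2Sq (fam 1 b) with hS
  have hS0 : 0 ≤ S := by
    rw [hS, l2Sq_fam 1 hb0]; positivity
  set a : ℝ := Real.sqrt (M / (S + 1)) with ha
  have hapos : 0 < a := Real.sqrt_pos.2 (div_pos hM (by linarith))
  have ha2 : a ^ 2 = M / (S + 1) := Real.sq_sqrt (div_pos hM (by linarith)).le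
  have hball : l2Sq (fam a b) ≤ M := by
    have : l2Sq (fam a b) = a ^ 2 * S := by
      rw [hS, l2Sq_fam a hb0, l2Sq_fam 1 hb0, one_pow, one_mul, mul_assoc]
    rw [this, ha2, div_mul_eq_mul_div, div_le_iff₀ (by linarith)]
    nlinarith
  have h1 := hle (fam a b) (inDA_fam a hb0.ne') hball
  rw [olSq_fam a hb0 hapos.ne', stokesSq_fam a hb0] at h1
  rw [stokesSq_fam 1 hb0, one_pow, one_mul] at hlt
  have ha2pos : 0 < a ^ 2 := by positivity
  -- h1 : Cstar * (a² olSq₁) ≤ a² b M' ; hlt : b M' < Cstar olSq₁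
  nlinarith [mul_lt_mul_of_pos_left hlt ha2pos]

end Summit.NavierStokesRegularity.NavierStokesRegularity.Theorems.Zeroual2026Retype
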